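import Summits.ResolutionOfSingularities.ResolutionOfSingularities.Theorems.FrobeniusLadderFInjectiveMacaulayficationRegularBlowupModelSupported
import Summits.ResolutionOfSingularities.ResolutionOfSingularities.Theorems.FrobeniusLadderFInjectiveMacaulayficationNormalAffineNeighbourhood
import Summits.ResolutionOfSingularities.ResolutionOfSingularities.Theorems.FrobeniusLadderFInjectiveMacaulayficationFCForallExistsRungs
import Summits.ResolutionOfSingularities.ResolutionOfSingularities.Theorems.FrobeniusLadderFInjectiveMacaulayficationPointFixableTransport
import Literature.AlgebraicGeometry.Resolution.NormalSurfaceSingularLocus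
import Literature.AlgebraicGeometry.Resolution.AlterationsBoundarySmoothLocus
import Literature.AlgebraicGeometry.Resolution.GenericPointStalkData
import Literature.AlgebraicGeometry.Resolution.SurfaceResolutionReduction
import HarnessLib

/-!
# T-LINE RUNG T2 — 5e⁺ (`H4LocTame`) IN DIMENSION `≤ 2` modulo Lipman 1978 ONLY: at a NORMAL bad closed point `b` with `dim 𝒪_{X₁,b} ≤ 2`
# there is an `𝔪_b`-primary centre of `𝒪_{X₁,b}` all of whose blow-up charts over `𝔪_b` are FULL (crux `FInjectiveMacaulayfication`
# stmt-ResolutionOfSingularities-15315, chain w45a; res-L1-w45a-plan-1 R13.46 (2); statement = res-L1-w45a-strat-1 `H4LocRepairSig.lean`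
# v1.4 9829be837b63b581 §9′ `H4LocTameDim2` with `CMCl`/`FCl`/`FullCl`/`PFixData`/`TameAt` EXPANDED; prover res-L1-w45a-stub-4)

[OURS · L1 W4.5a] Support file (`--supports stmt-ResolutionOfSingularities-15315 --as helper`); NOT a statement of any manuscript;
no definitions, no named fact introduced (Lipman 1978 = the tree's named fact `Lipman1978SequenceFinite`, BY NAME); AI-written (AI review
is weaker than expert review). Replaces the role of NOTHING in H. Hironaka's manuscript.

PROOF (no anti-ample cycle, no blow-up presentation (BP): the `𝔪_b`-PRIMARITY comes from SUPPORT TRACKING). `dim 𝒪_b ≤ 1` is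
impossible (normal of dimension `≤ 1` ⇒ regular ⇒ F-closed on parameters, contradicting badness). For `dim 𝒪_b = 2`: a normal affine
neighbourhood `U ∋ b` (`NormalAffineNeighbourhood.exists_normal_affineOpen`) is a normal surface; Lipman's tower over it is ONE blowing
up `π : Y → U` of a non-zero `J` supported in `Sing U` with `Y` regular (`RegularBlowupModelSupported.exists_regular_isBlowup_supported_of_lipman`);
`b ∈ supp J` (else `𝒪_b` ≅ a regular stalk, contradiction) and `b` is a maximal point of `supp J` (singular points of a normal surface are
closed, `isClosed_singleton_of_not_mem_regularLocus`), so `√(J_b) = 𝔪_b` (`radical_stalkIdeal_eq_maximalIdeal_of_mem_maxPoints`); the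
charts of `Bl_{J_b} Spec 𝒪_b` over `𝔪_b` have the (regular) local rings of `Y` over `b` (`IsBlowup.exists_point_of_blowupAlgebra_prime`,
Stacks 0804), hence are FULL (`FiClauseOfRegular`); finally `𝒪_{U,b} ≅ 𝒪_{X₁,b}` (`PointFixableTransport.pointFixable_of_ringEquiv`).
strat-1's `stub_rungT2_of_lipman hL` is `h4LocTameDim2_of_lipman hL` by `exact`.
[folklore assembly; cite: Liu2002, Thm. 8.3.44 (PDF p. 427); StacksProject, Tags 0804, 080B, 01J7]
-/

-- single-problem summit: the doubled namespace component is forced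
set_option linter.dupNamespace false

noncomputable section

open AlgebraicGeometry CategoryTheory Literature.AlgebraicGeometry.Resolution TopologicalSpace IsLocalRing

namespace Summit.ResolutionOfSingularities.ResolutionOfSingularities.Theorems.FInjectiveMacaulayfication.H4LocTameDim2

open Summit.ResolutionOfSingularities.ResolutionOfSingularities.Theorems.FInjectiveMacaulayfication

/-- **PFix at a normal bad closed point of a NORMAL SURFACE** (the core of T2): `U` a normal surface over a field of characteristic `p`,
`b ∈ U` a point whose local ring is not regular ⇒ an `𝔪_b`-primary non-zero `(c) ⊆ 𝒪_{U,b}` all of whose blow-up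
charts over `𝔪_b` are integral, Cohen–Macaulay and F-closed on parameters. [folklore assembly] -/
theorem pfix_of_normalSurface (hL : Lipman1978SequenceFinite.{0}) (p : ℕ) [Fact p.Prime] {k : Type} [Field k] [CharP k p]
    (S : NormalSurface k) (b : S.X) (hb : ¬ IsRegularLocalRing (S.X.presheaf.stalk b)) :
    ∃ (n : ℕ) (c : Fin n → S.X.presheaf.stalk b), Ideal.span (Set.range c) ≠ ⊥ ∧
      (Ideal.span (Set.range c)).radical = maximalIdeal (S.X.presheaf.stalk b) ∧
      ∀ (j : Fin n) (𝔔 : PrimeSpectrum (blowupAlgebra (Ideal.span (Set.range c)) (c j))),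
        𝔔.asIdeal.comap (algebraMap (S.X.presheaf.stalk b) (blowupAlgebra (Ideal.span (Set.range c)) (c j))) =
          maximalIdeal (S.X.presheaf.stalk b) →
        IsDomain (Localization.AtPrime 𝔔.asIdeal) ∧ ∀ d : ℕ, ringKrullDim (Localization.AtPrime 𝔔.asIdeal) = d →
          ∀ s : Fin d → Localization.AtPrime 𝔔.asIdeal, (Ideal.span (Set.range s)).radical.IsMaximal →
            RingTheory.Sequence.IsWeaklyRegular (Localization.AtPrime 𝔔.asIdeal) (List.ofFn s) ∧
            ∀ y : Localization.AtPrime 𝔔.asIdeal, (∃ e : ℕ, y ^ p ^ e ∈ Ideal.span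
              ((fun z : Localization.AtPrime 𝔔.asIdeal => z ^ p ^ e) '' (Ideal.span (Set.range s) : Set (Localization.AtPrime 𝔔.asIdeal)))) →
              y ∈ Ideal.span (Set.range s) := by
  classical
  have hp : p.Prime := Fact.out
  haveI : IsNoetherian S.X := Scheme.isNoetherian_of_finiteType_over_field S.hom
  obtain ⟨Y, g, π, J, hJ, hπ, hJT, hreg⟩ := RegularBlowupModelSupported.exists_regular_isBlowup_supported_of_lipman hL S
  -- characteristic `p` on the stalks of `Y`
  have hcharY : ∀ y : Y, CharP (Y.presheaf.stalk y) p := fun y =>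
    CharP.of_ringHom_of_ne_zero
      ((Y.presheaf.germ ⊤ y trivial).hom.comp ((π ≫ S.hom).appTop.hom.comp (Scheme.ΓSpecIso (.of k)).inv.hom)) p hp.ne_zero
  -- `b ∈ supp J`: else the stalk at `b` is regular, hence F-closed on parameters
  have hbsupp : b ∈ (J.support : Set S.X) := by
    by_contra hnot
    obtain ⟨t, ht⟩ := hπ.exists_preimage_of_not_mem_support hnot
    obtain ⟨e⟩ := IsBlowupStalkOffSupport.stub_isBlowupStalkOffSupport S.X Y J π hπ t (by rw [ht]; exact hnot)
    haveI : IsRegularLocalRing (Y.presheaf.stalk t) := hreg t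
    have hreg' : IsRegularLocalRing (S.X.presheaf.stalk (π.base t)) := IsRegularLocalRing.of_ringEquiv e
    have hη' : π.base t = b := ht
    rw [hη'] at hreg'
    exact hb hreg'
  -- `b` is a maximal point of `supp J ⊆ Sing U` (singular points of a normal surface are closed), so `√(J_b) = 𝔪_b`
  have hbmax : b ∈ maxPoints (J.support : Set S.X) := by
    refine mem_maxPoints_iff.mpr ⟨hbsupp, fun η' hη' hsp => ?_⟩
    have hcl : IsClosed ({η'} : Set S.X) :=
      isClosed_singleton_of_not_mem_regularLocus S.normal S.dim_eq.le (hJT hη')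
    have : b ∈ closure ({η'} : Set S.X) := hsp.mem_closure
    rw [hcl.closure_eq] at this
    exact (Set.mem_singleton_iff.mp this).symm ▸ rfl
  have hrad : (stalkIdeal J b).radical = maximalIdeal (S.X.presheaf.stalk b) :=
    radical_stalkIdeal_eq_maximalIdeal_of_mem_maxPoints hbmax
  -- `c` := generators of `J_b`
  obtain ⟨n, c, hc⟩ : ∃ (n : ℕ) (c : Fin n → S.X.presheaf.stalk b), Ideal.span (Set.range c) = stalkIdeal J b :=
    Submodule.fg_iff_exists_fin_generating_family.mp (IsNoetherian.noetherian _)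
  refine ⟨n, c, ?_, ?_, ?_⟩
  · rw [hc]; exact stalkIdeal_ne_bot_of_ne_bot hJ b
  · rw [hc]; exact hrad
  · intro j 𝔔 h𝔔
    obtain ⟨y, -, ⟨e⟩⟩ := hπ.exists_point_of_blowupAlgebra_prime b c hc j 𝔔 h𝔔
    haveI : IsRegularLocalRing (Y.presheaf.stalk y) := hreg y
    haveI : IsRegularLocalRing (Localization.AtPrime 𝔔.asIdeal) := IsRegularLocalRing.of_ringEquiv e
    haveI : CharP (Y.presheaf.stalk y) p := hcharY y
    haveI : CharP (Localization.AtPrime 𝔔.asIdeal) p := charP_of_injective_ringHom (f := e.toRingHom) e.injective p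
    exact FiClauseOfRegular.stub_fiClauseOfRegular p (Localization.AtPrime 𝔔.asIdeal)

/-- **T2 — 5e⁺ IN DIMENSION `≤ 2`, modulo Lipman 1978 ONLY** (strat-1's `H4LocTameDim2`, Sig v1.4, binders expanded): for an
integral `k`-scheme `X₁` of finite type (separated; all stalks Cohen–Macaulay and finitely many non-F-closed points — unused) and a
closed point `b` whose local ring is NOT F-closed on parameters, IS integrally closed and has dimension `≤ 2`, the local ring
`𝒪_{X₁,b}` is point-fixable: some `𝔪_b`-primary non-zero `(c)` has all blow-up charts over `𝔪_b` integral, Cohen–Macaulay and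
F-closed on parameters. [folklore assembly; cite: Liu2002, Thm. 8.3.44 (PDF p. 427)] -/
theorem h4LocTameDim2_of_lipman (hL : Lipman1978SequenceFinite.{0}) :
    ∀ (p : ℕ), p.Prime → ∀ (k : Type) [Field k] [CharP k p] (X₁ : Scheme.{0}) (f₁ : X₁ ⟶ Spec (.of k)),
    IsSeparated f₁ → LocallyOfFiniteType f₁ → QuasiCompact f₁ → IsIntegral X₁ →
    (∀ x : X₁, ∀ d : ℕ, ringKrullDim (X₁.presheaf.stalk x) = d → ∀ s : Fin d → X₁.presheaf.stalk x,
      (Ideal.span (Set.range s)).radical.IsMaximal → RingTheory.Sequence.IsWeaklyRegular (X₁.presheaf.stalk x) (List.ofFn s)) →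
    Set.Finite {x : X₁ | ¬ ∀ d : ℕ, ringKrullDim (X₁.presheaf.stalk x) = d → ∀ s : Fin d → X₁.presheaf.stalk x,
      (Ideal.span (Set.range s)).radical.IsMaximal →
        ∀ y : X₁.presheaf.stalk x, (∃ e : ℕ, y ^ p ^ e ∈ Ideal.span ((fun z : X₁.presheaf.stalk x => z ^ p ^ e) ''
          (Ideal.span (Set.range s) : Set (X₁.presheaf.stalk x)))) → y ∈ Ideal.span (Set.range s)} →
    ∀ b : X₁, IsClosed ({b} : Set X₁) →
      ¬ (∀ d : ℕ, ringKrullDim (X₁.presheaf.stalk b) = d → ∀ s : Fin d → X₁.presheaf.stalk b,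
        (Ideal.span (Set.range s)).radical.IsMaximal →
          ∀ y : X₁.presheaf.stalk b, (∃ e : ℕ, y ^ p ^ e ∈ Ideal.span ((fun z : X₁.presheaf.stalk b => z ^ p ^ e) ''
            (Ideal.span (Set.range s) : Set (X₁.presheaf.stalk b)))) → y ∈ Ideal.span (Set.range s)) →
      IsIntegrallyClosed (X₁.presheaf.stalk b) → ringKrullDim (X₁.presheaf.stalk b) ≤ 2 →
      ∃ (n : ℕ) (c : Fin n → X₁.presheaf.stalk b), Ideal.span (Set.range c) ≠ ⊥ ∧
        (Ideal.span (Set.range c)).radical = maximalIdeal (X₁.presheaf.stalk b) ∧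
        ∀ (j : Fin n) (𝔔 : PrimeSpectrum (blowupAlgebra (Ideal.span (Set.range c)) (c j))),
          𝔔.asIdeal.comap (algebraMap (X₁.presheaf.stalk b) (blowupAlgebra (Ideal.span (Set.range c)) (c j))) =
            maximalIdeal (X₁.presheaf.stalk b) →
          IsDomain (Localization.AtPrime 𝔔.asIdeal) ∧ ∀ d : ℕ, ringKrullDim (Localization.AtPrime 𝔔.asIdeal) = d →
            ∀ s : Fin d → Localization.AtPrime 𝔔.asIdeal, (Ideal.span (Set.range s)).radical.IsMaximal →
              RingTheory.Sequence.IsWeaklyRegular (Localization.AtPrime 𝔔.asIdeal) (List.ofFn s) ∧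
              ∀ y : Localization.AtPrime 𝔔.asIdeal, (∃ e : ℕ, y ^ p ^ e ∈ Ideal.span
                ((fun z : Localization.AtPrime 𝔔.asIdeal => z ^ p ^ e) '' (Ideal.span (Set.range s) : Set (Localization.AtPrime 𝔔.asIdeal)))) →
                y ∈ Ideal.span (Set.range s) := by
  intro p hp k _ _ X₁ f₁ hsep hft hqc hint _ _ b hbcl hb hnorm hdim
  haveI := hsep; haveI := hft; haveI := hqc; haveI := hint
  haveI : Fact p.Prime := ⟨hp⟩
  haveI : IsNoetherian X₁ := Scheme.isNoetherian_of_finiteType_over_field f₁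
  -- `dim 𝒪_b ≤ 1` is impossible: normal of dimension `≤ 1` is regular, hence F-closed on parameters
  rcases le_one_or_eq_two_of_le_two hdim with h1 | h2
  · exfalso
    haveI := hnorm
    have hregb : IsRegularLocalRing (X₁.presheaf.stalk b) :=
      isRegularLocalRing_of_isIntegrallyClosed_of_ringKrullDim_le_one (X₁.presheaf.stalk b) h1
    have hcl := (RegularPointClause.fiClause_stalk_of_isRegularLocalRing p f₁ b hregb).2
    exact hb fun d hd s hs u hu => (hcl d hd s hs).2 u hu
  -- a normal affine neighbourhood `U ∋ b`, a normal surface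
  obtain ⟨U, hU, hbU, -, hUn⟩ := NormalAffineNeighbourhood.exists_normal_affineOpen X₁ f₁ b hnorm
  let b' : (U : Scheme.{0}) := ⟨b, hbU⟩
  let eb : (X₁.presheaf.stalk b) ≃+* ((U : Scheme.{0}).presheaf.stalk b') :=
    (asIso (U.ι.stalkMap b')).commRingCatIsoToRingEquiv
  haveI : IsAffine (U : Scheme.{0}) := hU
  haveI : Nonempty (U : Scheme.{0}) := ⟨b'⟩
  haveI : IsIntegral (U : Scheme.{0}) := isIntegral_of_isOpenImmersion U.ι
  haveI : QuasiCompact (U.ι ≫ f₁) := (HasAffineProperty.iff_of_isAffine (P := @QuasiCompact)).mpr inferInstance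
  have hb'cl : IsClosed ({b'} : Set (U : Scheme.{0})) := by
    have h := hbcl.preimage U.ι.continuous
    have hset : (U.ι.base ⁻¹' {b} : Set (U : Scheme.{0})) = {b'} := by
      ext u
      simp only [Set.mem_preimage, Set.mem_singleton_iff]
      constructor
      · intro hu; exact Subtype.ext hu
      · intro hu; rw [hu]; rfl
    rw [hset] at h
    exact h
  have hdimU : topologicalKrullDim (U : Scheme.{0}) = 2 := by
    rw [← ringKrullDim_stalk_eq_of_isClosed (U.ι ≫ f₁) hb'cl, ← ringKrullDim_eq_of_ringEquiv eb, h2]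
  let S : NormalSurface k :=
    { X := U, hom := U.ι ≫ f₁, isSeparated := inferInstance, locallyOfFiniteType := inferInstance,
      quasiCompact := inferInstance, isIntegral := inferInstance,
      normal := fun u => by
        haveI := hUn (U.ι.base u) u.2
        exact IsIntegrallyClosed.of_equiv (asIso (U.ι.stalkMap u)).commRingCatIsoToRingEquiv
      dim_eq := hdimU }
  -- `𝒪_{X₁,b}` is not regular (regular ⇒ F-closed on parameters), hence neither is `𝒪_{U,b'} ≅ 𝒪_{X₁,b}`
  have hnreg : ¬ IsRegularLocalRing (S.X.presheaf.stalk b') := by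
    intro hr
    have hregb : IsRegularLocalRing (X₁.presheaf.stalk b) := IsRegularLocalRing.of_ringEquiv eb.symm
    have hcl := (RegularPointClause.fiClause_stalk_of_isRegularLocalRing p f₁ b hregb).2
    exact hb fun d hd s hs u hu => (hcl d hd s hs).2 u hu
  -- PFix at `b'` on the normal surface, transported to `𝒪_{X₁,b}`
  exact PointFixableTransport.pointFixable_of_ringEquiv p eb.symm (pfix_of_normalSurface hL p S b' hnreg)

end Summit.ResolutionOfSingularities.ResolutionOfSingularities.Theorems.FInjectiveMacaulayfication.H4LocTameDim2

end
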